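import Mathlib.NumberTheory.LegendreSymbol.ZModChar
import Literature.NumberTheory.EllipticCurves.CastellaHsieh2018.BranchBDPLFunctionValueAtConductorP
import Literature.NumberTheory.LFunctions.GaussSumTwoPowerNorm

/-!
# STUB-IDEAS k2 g46 — `stub_heegnerIndexLowerAtTwo` (crux `PrintCf2.SplitBadTwoLowerHalfOfFacts`,
# stmt-BirchSwinnertonDyer-27851): literature transfer (typed dictionary) — Castella–Hsieh 2018 §5
# (Lemma 5.4 + Thm. 5.1 + Thm. 5.7, the tree's ODD-`p` fact
# `castellaHsieh2018_branchValue_conductorP`) carried to `p = 2` FOR THE TWIN `A′ = W ⊗ χ_ε` at the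
# even genus characters of conductor `2^{n(ε)}` = FALLBACK 2's residues (Rδ-1′)₂ / (Rδ-2)₂ TYPED.

HONEST FRAMING. BSD is not proved by anything here; the crux is not proved; the stub is not proved;
nothing below moves LOWER (FALLBACK 2 = road δ is unstaffed, STUB-PLAN v8.1 §4; HARDEST (a)/(b)
untouched; K65 / B81 honoured: the shift digits `n(−1) = 2`, `n(±2) = 3` are OF RECORD (k2-g45 /
T3.1) and only USED here). The two `…_UNPRINTED` Props are TRANSFER TARGETS (research statements at
`p = 2`, NOT printed facts): Castella–Hsieh print `p` odd [arXiv:1505.08165v1 p0003 L4, p0006 L12],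
Loeffler–Zerbes [LZ2] prints `p` odd [arXiv:1108.5954 p0003 L5, p0004 L5]. Everything PROVED below is
digit arithmetic (`decide` / `norm_num`) or norm bookkeeping; no `sorry`, no `axiom`, no `instance`.
-/

noncomputable section

open scoped Classical

open NumberField IsDedekindDomain Field Literature.NumberTheory.EllipticCurves.ModularForms
open Literature.NumberTheory.GaloisRepresentations Literature.NumberTheory.EllipticCurves

namespace Summit.BirchSwinnertonDyer.BirchSwinnertonDyer.Cruxes.SplitBadTwoLowerHalfOfFacts.TransferCH18AtTwoK2G46

/-! ## §1 The three even genus data `(χ_{d*} mod 8, d*, n)` and their decided digits -/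

/-- `χ₋₄` read modulo `8` (imprimitive): `χ₈ · χ₈′` (`χ₈′ = χ₋₄ χ₈`). -/
def chi4At8 : MulChar (ZMod 8) ℤ := ZMod.χ₈ * ZMod.χ₈'

/-- `χ₈ χ₈′` is `χ₋₄ ∘ (mod 4)` on `ℤ/8`. -/
theorem chi4At8_apply (a : ZMod 8) : chi4At8 a = ZMod.χ₄ (a.val : ZMod 4) := by
  simp only [chi4At8, MulChar.coeToFun_mul, Pi.mul_apply]
  revert a
  decide

/-- The Dirichlet side of the three even genus characters of `K` (2 split in `K`): `d* = −1, 2, −2`. -/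
def evenGenusDir : Fin 3 → MulChar (ZMod 8) ℤ := ![chi4At8, ZMod.χ₈, ZMod.χ₈']

/-- `d*`: the square class cut out in `K[2^n]` (`θ² = d*`). -/
def evenGenusDisc : Fin 3 → ℤ := ![-1, 2, -2]

/-- `n(ε)`: the conductor exponent at each prime above `2` — OF RECORD (k2-g45 `…_conductorExp_sharp`,
T3.1's `n_v`), restated only to index the table. -/
def evenGenusExp : Fin 3 → ℕ := ![2, 3, 3]

/-- EXACT LEVEL `n` in the sense of the tree's `GaussSumTwoPower.norm_gaussSum_two_pow`
(`f(1 + 2ⁿ⁻¹) = −1`): the hypothesis under which `‖𝔤(χ)‖₂ = 2^{−n/2}` is a tree theorem. -/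
theorem evenGenusDir_exactLevel (k : Fin 3) :
    evenGenusDir k (1 + 2 ^ (evenGenusExp k - 1) : ZMod 8) = -1 := by
  fin_cases k
  · show chi4At8 (1 + 2 ^ 1 : ZMod 8) = -1; rw [chi4At8_apply]; decide
  · show ZMod.χ₈ (1 + 2 ^ 2 : ZMod 8) = -1; decide
  · show ZMod.χ₈' (1 + 2 ^ 2 : ZMod 8) = -1; decide

/-- The parity digits `χ(−1)`: `χ₋₄(−1) = −1`, `χ₈(−1) = 1`, `χ₋₈(−1) = −1`. -/
theorem evenGenusDir_neg_one (k : Fin 3) :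
    evenGenusDir k (-1 : ZMod 8) = ![(-1 : ℤ), 1, -1] k := by
  fin_cases k
  · show chi4At8 (-1 : ZMod 8) = -1; rw [chi4At8_apply]; decide
  · show ZMod.χ₈ (-1 : ZMod 8) = 1; decide
  · show ZMod.χ₈' (-1 : ZMod 8) = -1; decide

/-- **NEW DIGIT (descended cofactor is uniform).** Undescended, the Castella–Hsieh §5 chain gives the
cofactor `χ(−1)·2^{−n}` (`𝔤(χ_𝔭⁻¹)² · (2^{−n})²` with `𝔤² = χ(−1)·2ⁿ`); descending the genus point to
`W = A′ ⊗ χ_ε` through the twisting isomorphism multiplies `log²` by `θ² = d*`. For all three keys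
`χ(−1) · d* · 2^{−n(ε)} = 1/4`: the descended cofactor is `+2^{−2}` uniformly (at odd `p` it is a unit). -/
theorem descended_cofactor (k : Fin 3) :
    ((evenGenusDir k (-1 : ZMod 8) : ℤ) : ℚ) * (evenGenusDisc k : ℚ) *
      (2 : ℚ) ^ (-(evenGenusExp k : ℤ)) = 1 / 4 := by
  rw [evenGenusDir_neg_one]
  fin_cases k <;> simp [evenGenusDisc, evenGenusExp] <;> norm_num

/-- Norm bookkeeping = road δ's `x`-law is an EQUALITY: in any normed field with `‖2‖ = ½`
(`ℂ₂`), `‖u · 2^{−n} · x²‖ = 2ⁿ · ‖x‖²` for a unit `u`; i.e. `v₂(value) = 2·v₂(x) − n`. -/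
theorem norm_value_shape {F : Type*} [NormedField F] (h2 : ‖(2 : F)‖ = 2⁻¹) (u x : F)
    (hu : ‖u‖ = 1) (n : ℕ) :
    ‖u * (2 : F) ^ (-(n : ℤ)) * x ^ 2‖ = 2 ^ n * ‖x‖ ^ 2 := by
  rw [norm_mul, norm_mul, hu, one_mul, norm_zpow, h2, norm_pow, zpow_neg, zpow_natCast, inv_pow,
    inv_inv]

/-! ## §2 The even genus Hecke characters of `K` (pattern of the tree's `genusHeckeCharacter K p`,
which at `p = 2` is trivial: `quadraticChar (ZMod 2) = 1`) -/

/-- `χ̃ = χ_{d*} ∘ N_{K/ℚ}` for the three even genus data. -/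
def evenGenusHecke (K : Type) [Field K] [NumberField K] [IsGalois ℚ K] (k : Fin 3) :
    HeckeCharacter K :=
  (HeckeCharacter.ofDirichlet ((evenGenusDir k).ringHomComp (Int.castRingHom ℂ))).compRelNorm K

/-! ## §3 (Rδ-1′)₂ TYPED — the `χ`-branch frame EXISTS at `p = 2` for a 2-ordinary newform of ODD
level on a quadratic branch character of 2-power conductor exponent `n ∈ {2, 3}`.
Dictionary against `castellaHsieh2018_exists_isBranchBDPLFunction` (the sibling fact), binder by binder:
`p ≠ 2` DROPPED (the transfer); `¬ p ∣ N` KEPT (`A′` has odd level); split / `𝔭` / `ι` / (Heeg) / `κ` /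
`γ` KEPT verbatim; branch character: `χ² = 1`, unramified off `2` KEPT, conductor exponent `1 ↦ n`.
NOT PRINTED: CH §2.3 "we assume that p > 2" [p0006 L12]. Located non-transferring steps: see the card. -/

/-- (Rδ-1′)₂, typed. UNPRINTED transfer target; `def … : Prop`, nothing asserted. -/
def existsBranchBDPLFunction_atTwo_UNPRINTED : Prop :=
  ∀ (ι : PadicAlgCl 2 ≃+* ℂ) (A : WeierstrassCurve ℚ) [A.IsElliptic]
    (K : Type) [Field K] [NumberField K] (𝔭 : HeightOneSpectrum (𝓞 K)) (κ : ZpExtension K 2)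
    (γ : absoluteGaloisGroup K) {N : ℕ} [NeZero N] {f : CuspForm (CongruenceSubgroup.Gamma0 N) 2}
    (_ : IsNewformOf A f) (χ : HeckeCharacter K) (n : ℕ),
    (n = 2 ∨ n = 3) → ¬ 2 ∣ N → ¬ (2 : ℤ) ∣ A.LFunction 2 →
    IsImaginaryQuadratic K → ((Ideal.span {(2 : ℤ)}).primesOver (𝓞 K)).ncard = 2 →
    ((2 : ℕ) : 𝓞 K) ∈ 𝔭.asIdeal →
    (∀ (w : InfinitePlace K) (k : 𝓞 K),
      k ∈ 𝔭.asIdeal ↔ ‖ι.symm (w.embedding (k : K))‖ < 1) →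
    SatisfiesHeegnerHypothesis N K →
    κ.IsAnticyclotomic → κ.IsTopGenerator γ →
    χ ^ 2 = 1 →
    (∀ w : HeightOneSpectrum (𝓞 K), ((2 : ℕ) : 𝓞 K) ∉ w.asIdeal → χ.IsUnramifiedAt w) →
    (∀ 𝔮 : HeightOneSpectrum (𝓞 K), ((2 : ℕ) : 𝓞 K) ∈ 𝔮.asIdeal → χ.HasConductorExponentAt 𝔮 n) →
    ∃ (e : ℂ) (ΩK : ℂ) (Ωp : (unrIntegers 2)ˣ) (L : UnrSeries 2),
      e ≠ 0 ∧ ΩK ≠ 0 ∧ IsBranchBDPLFunction ι 𝔭 κ γ f χ e ΩK ((Ωp : unrIntegers 2) : ℂ_[2]) L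

/-! ## §4 (Rδ-2)₂ TYPED — the VALUE of the even-genus branch at `T = 0` for the twin:
`L(0) = u · 2^{−n(ε)} · (log_{ω_{A′}}(Σ_τ s(τ)·τy)/c)²`, `y` the Heegner point of `A′` of conductor
`2^{n(ε)}`, `θ² = d*`, `s` the sign cocycle of `θ` on `Gal(K[2^{n(ε)}]/K)`, `u ∈ R₀^×`.
Dictionary against `castellaHsieh2018_branchValue_conductorP`, binder by binder: `p ≠ 2` DROPPED;
`¬ p ∣ φ(N)` DROPPED (at `p = 2` it fails for every `N ≥ 3` — (H)(a) [p0003 L34, p0012 L53] is the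
first located non-transferring step, S1 of the card); `¬ p ∣ N`, ordinarity `¬ 2 ∣ a₂(A′)`, `Odd d_K`,
`d_K ≠ −3`, split, `𝔭`, `ι`, (Heeg), `β`, `κ`, `γ` KEPT; `genusHeckeCharacter K p ↦ evenGenusHecke K k`;
conductor `p ↦ 2^{n(ε)}`; `θ² = p* ↦ θ² = d*`; cofactor `p⁻¹ ↦ 2^{−n(ε)}` (DECIDED: `𝔤(χ_𝔭⁻¹)²·2^{−2n}`,
`‖𝔤‖₂ = 2^{−n/2}` = tree `GaussSumTwoPower.norm_gaussSum_two_pow` under `evenGenusDir_exactLevel`; the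
global constant `2^{#A(χ)+3}u_K²√D_K/4` of CH Prop. 3.6 vs Castella's frame [p0010 L14, p0011 L8–9;
arXiv:1704.06608 p0009 L22–34] is absorbed by the FREE branch constant `e`, the `n`-dependent
`(4D_K)^n` by the complex witness `Ω_K` — so the frame currency survives at `2` only because `e`, `Ω_K`
are existential). UNPRINTED transfer target; `def … : Prop`, nothing asserted. -/
def branchValue_conductorTwoPower_UNPRINTED : Prop :=
  ∀ (ι : PadicAlgCl 2 ≃+* ℂ) (A : WeierstrassCurve ℚ) [A.IsElliptic]
    [A.IsGloballyMinimal] (K : Type) [Field K] [NumberField K] [IsGalois ℚ K] (ι₀ : K →+* ℂ)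
    (𝔭 : HeightOneSpectrum (𝓞 K)) (κ : ZpExtension K 2) (γ : absoluteGaloisGroup K) {N : ℕ}
    [NeZero N] (Dt : ModularParametrizationData A N) (β : ℤ) (k : Fin 3),
    ¬ 2 ∣ N → ¬ (2 : ℤ) ∣ A.LFunction 2 →
    IsImaginaryQuadratic K → Odd (NumberField.discr K) → NumberField.discr K ≠ -3 →
    ((Ideal.span {(2 : ℤ)}).primesOver (𝓞 K)).ncard = 2 →
    ((2 : ℕ) : 𝓞 K) ∈ 𝔭.asIdeal →
    (∀ (w : InfinitePlace K) (k : 𝓞 K),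
      k ∈ 𝔭.asIdeal ↔ ‖ι.symm (w.embedding (k : K))‖ < 1) →
    SatisfiesHeegnerHypothesis N K → (4 * (N : ℤ)) ∣ β ^ 2 - NumberField.discr K →
    κ.IsAnticyclotomic → κ.IsTopGenerator γ →
    ∃ (e : ℂ) (ΩK : ℂ) (Ωp : (unrIntegers 2)ˣ) (L : UnrSeries 2),
      e ≠ 0 ∧ ΩK ≠ 0 ∧
      IsBranchBDPLFunction ι 𝔭 κ γ Dt.f (evenGenusHecke K k) e ΩK
        ((Ωp : unrIntegers 2) : ℂ_[2]) L ∧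
      ∃ u : (unrIntegers 2)ˣ,
        ∀ [NumberField (ringClassField K ι₀ (2 ^ evenGenusExp k))]
          [(A.baseChange ℂ_[2]).IsIntegral (NormedField.valuation (K := ℂ_[2])).integer]
          (y : (A.baseChange (ringClassField K ι₀ (2 ^ evenGenusExp k) : Type)).toAffine.Point),
          WeierstrassCurve.Affine.Point.map
              (ringClassField K ι₀ (2 ^ evenGenusExp k)).subtype.toRatAlgHom y =
            heegnerPointComplexOfConductor Dt (NumberField.discr K) β (2 ^ evenGenusExp k) →
          ∀ (θ : ringClassField K ι₀ (2 ^ evenGenusExp k)),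
            θ ^ 2 = algebraMap ℚ (ringClassField K ι₀ (2 ^ evenGenusExp k)) (evenGenusDisc k : ℚ) →
          ∀ (s : ringClassGal ι₀ (2 ^ evenGenusExp k) → ℤˣ),
            (∀ σ : ringClassGal ι₀ (2 ^ evenGenusExp k),
              σ.1 θ = ((s σ : ℤ) : ringClassField K ι₀ (2 ^ evenGenusExp k)) * θ) →
          ∀ (j : ringClassField K ι₀ (2 ^ evenGenusExp k) →+* ℂ_[2]),
            (∀ k' : 𝓞 K, k' ∈ 𝔭.asIdeal ↔
              ‖j (algebraMap K (ringClassField K ι₀ (2 ^ evenGenusExp k)) (k' : K))‖ < 1) →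
            L.HasValueAt 0
              (((u : unrIntegers 2) : ℂ_[2]) * (2 : ℂ_[2]) ^ (-(evenGenusExp k : ℤ)) *
                (FormalGroupChart.padicLogPointFiniteExt (NormedField.valuation (K := ℂ_[2]))
                    (A.baseChange ℂ_[2]) 2
                    (WeierstrassCurve.Affine.Point.map j.toRatAlgHom
                      (∑ τ : ringClassGal ι₀ (2 ^ evenGenusExp k),
                        (s τ : ℤ) • pointGalHom A (ringClassField K ι₀ (2 ^ evenGenusExp k) : Type)
                          τ.1 y)) /
                  (Dt.c : ℂ_[2])) ^ 2)

/-! ## §5 Glue (proved): the value fact yields the frame; the shape is non-zero iff the log is -/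

/-- Forgetting the value: (Rδ-2)₂ ⟹ the even-genus branch frame exists (shape of (Rδ-1′)₂'s
conclusion for `χ = evenGenusHecke K k`). Pure logic. -/
theorem branchValue_conductorTwoPower_UNPRINTED.exists_frame
    (h : branchValue_conductorTwoPower_UNPRINTED) (ι : PadicAlgCl 2 ≃+* ℂ)
    (A : WeierstrassCurve ℚ) [A.IsElliptic] [A.IsGloballyMinimal] (K : Type) [Field K]
    [NumberField K] [IsGalois ℚ K] (ι₀ : K →+* ℂ) (𝔭 : HeightOneSpectrum (𝓞 K))
    (κ : ZpExtension K 2) (γ : absoluteGaloisGroup K) {N : ℕ} [NeZero N]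
    (Dt : ModularParametrizationData A N) (β : ℤ) (k : Fin 3)
    (hN : ¬ 2 ∣ N) (hord : ¬ (2 : ℤ) ∣ A.LFunction 2) (hK : IsImaginaryQuadratic K)
    (hodd : Odd (NumberField.discr K)) (h3 : NumberField.discr K ≠ -3)
    (hsplit : ((Ideal.span {(2 : ℤ)}).primesOver (𝓞 K)).ncard = 2)
    (h𝔭 : ((2 : ℕ) : 𝓞 K) ∈ 𝔭.asIdeal)
    (hι : ∀ (w : InfinitePlace K) (k : 𝓞 K), k ∈ 𝔭.asIdeal ↔ ‖ι.symm (w.embedding (k : K))‖ < 1)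
    (hH : SatisfiesHeegnerHypothesis N K) (hβ : (4 * (N : ℤ)) ∣ β ^ 2 - NumberField.discr K)
    (hκ : κ.IsAnticyclotomic) (hγ : κ.IsTopGenerator γ) :
    ∃ (e : ℂ) (ΩK : ℂ) (Ωp : (unrIntegers 2)ˣ) (L : UnrSeries 2),
      e ≠ 0 ∧ ΩK ≠ 0 ∧
      IsBranchBDPLFunction ι 𝔭 κ γ Dt.f (evenGenusHecke K k) e ΩK
        ((Ωp : unrIntegers 2) : ℂ_[2]) L := by
  obtain ⟨e, ΩK, Ωp, L, he, hΩ, hL, -⟩ :=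
    h ι A K ι₀ 𝔭 κ γ Dt β k hN hord hK hodd h3 hsplit h𝔭 hι hH hβ hκ hγ
  exact ⟨e, ΩK, Ωp, L, he, hΩ, hL⟩

/-- The value shape `u · 2^{−n} · x²` vanishes iff `x = 0` (consumers pair this with
`padicLogPointFiniteExt_eq_zero_iff`, as for the tree's `branchValueShape_ne_zero`). -/
theorem valueShape_eq_zero_iff (u : (unrIntegers 2)ˣ) (n : ℕ) (x : ℂ_[2]) :
    ((u : unrIntegers 2) : ℂ_[2]) * (2 : ℂ_[2]) ^ (-(n : ℤ)) * x ^ 2 = 0 ↔ x = 0 := by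
  have hu : ((u : unrIntegers 2) : ℂ_[2]) ≠ 0 := by
    intro h0
    have : (u : unrIntegers 2) = 0 := Subtype.ext h0
    exact u.ne_zero this
  have h2 : (2 : ℂ_[2]) ^ (-(n : ℤ)) ≠ 0 := zpow_ne_zero _ (by norm_num)
  constructor
  · intro h
    rcases mul_eq_zero.mp h with h' | h'
    · rcases mul_eq_zero.mp h' with h'' | h''
      · exact absurd h'' hu
      · exact absurd h'' h2
    · exact pow_eq_zero_iff (n := 2) (by norm_num) |>.mp h'
  · rintro rfl; simp

end Summit.BirchSwinnertonDyer.BirchSwinnertonDyer.Cruxes.SplitBadTwoLowerHalfOfFacts.TransferCH18AtTwoK2G46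

end
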